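import Mathlib.Analysis.SpecialFunctions.SmoothTransition
import Mathlib.Analysis.InnerProductSpace.Calculus
import Literature.Analysis.FluidPDE.SobolevWholeSpace
import Literature.Analysis.FluidPDE.TaoEnstrophyLocalisationProofs
import Literature.Analysis.FluidPDE.VectorCalculus
import HarnessLib

/-! # The Sobolev inequality `Ḣ¹ ∩ L⁶ ⊂ L⁶` on `ℝ³` without compact support, Frobenius form — crux stmt-NavierStokesRegularity-0893 (`GaldiLiouvilleGate.ParabolicGaldiLiouville`), line registered (birth), stub stub_sobolevSixFrobenius

Registered stub `stub_sobolevSixFrobenius` (`--supports stmt-NavierStokesRegularity-0893`), the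
pure real-analysis input of the dissipation gate: there is a constant `K` such that every `C¹`
field `u : ℝ³ → ℝ³` with `u ∈ L⁶` satisfies
`‖u‖_{L⁶} ≤ K (∫ |∇u|_F²)^{1/2}`, where `|∇u(y)|_F² = frobeniusNormSq (fderiv ℝ u y)` is the
Frobenius density (which dominates the operator norm squared,
`Literature.Analysis.FluidPDE.sq_opNorm_le_frobeniusNormSq`). The hypothesis `u ∈ L⁶` only
serves to exclude the constants.

Proof (RANGE truncation, Evans, *PDE*, §5.6.1, Thm. 2 with a cut-off in the target instead of
the source). Fix a `C¹` map `ψ : ℝ³ → ℝ³` with `‖Dψ‖ ≤ L`, `‖ψ w‖ ≤ ‖w‖³` and `ψ w = w` for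
`‖w‖² ≥ 2` (`ψ w = smoothTransition (‖w‖² - 1) • w`; the derivative bound is compactness of the
ball `‖w‖ ≤ 2` plus `Dψ = id` outside it). Put `u_n = (n+1)⁻¹ ψ((n+1) u)`. Then `u_n` is `C¹`,
`‖u_n x‖ ≤ (n+1)² ‖u x‖³` so that `u_n ∈ L²` (from `u ∈ L⁶`), and by the chain rule
`‖Du_n(x)‖ ≤ L ‖Du(x)‖`. The tree's Gagliardo–Nirenberg–Sobolev inequality for `C¹ ∩ L²` fields
(`Literature.Analysis.FluidPDE.eLpNorm_six_le_eLpNorm_fderiv_two`, no compact support) gives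
`‖u_n‖₆ ≤ K₀ ‖Du_n‖₂ ≤ K₀ L ‖Du‖₂`; since `u_n x = u x` as soon as `(n+1)‖u x‖² ≥ 2`, `u_n → u`
pointwise and Fatou's lemma in `L⁶` (`MeasureTheory.Lp.eLpNorm_lim_le_liminf_eLpNorm`) yields
`‖u‖₆ ≤ K₀ L ‖Du‖₂ ≤ K₀ L (∫ |∇u|_F²)^{1/2}`.
-/

noncomputable section

set_option linter.dupNamespace false

namespace Summit.NavierStokesRegularity.NavierStokesRegularity.Theorems.ParabolicGaldiLiouville.Birth

open MeasureTheory Filter Topology Set Function Module Metric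
open scoped ENNReal NNReal
open Literature.Analysis.FluidPDE

namespace SobolevSix

/-- **Range cut-off.** On a finite-dimensional real inner product space `V` there is a `C¹` map
`ψ : V → V` with globally bounded derivative, vanishing to third order at the origin
(`‖ψ w‖ ≤ ‖w‖³`, in particular `ψ = 0` on the unit ball) and equal to the identity on
`{‖w‖² ≥ 2}`: `ψ w = smoothTransition (‖w‖² - 1) • w`. -/
theorem exists_rangeCutoff (V : Type*) [NormedAddCommGroup V] [InnerProductSpace ℝ V]
    [FiniteDimensional ℝ V] :
    ∃ (ψ : V → V) (L : ℝ), ContDiff ℝ 1 ψ ∧ (∀ w, ‖fderiv ℝ ψ w‖ ≤ L) ∧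
      (∀ w, ‖ψ w‖ ≤ ‖w‖ ^ 3) ∧ (∀ w, 2 ≤ ‖w‖ ^ 2 → ψ w = w) := by
  set ψ : V → V := fun w => Real.smoothTransition (‖w‖ ^ 2 - 1) • w with hψdef
  have hψ : ContDiff ℝ 1 ψ :=
    (Real.smoothTransition.contDiff.comp ((contDiff_norm_sq ℝ).sub contDiff_const)).smul
      contDiff_id
  have hid : ∀ w : V, 2 ≤ ‖w‖ ^ 2 → ψ w = w := fun w hw => by
    simp only [hψdef]
    rw [Real.smoothTransition.one_of_one_le (by linarith), one_smul]
  have hcont : Continuous (fderiv ℝ ψ) := hψ.continuous_fderiv one_ne_zero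
  obtain ⟨C, hC⟩ :=
    (isCompact_closedBall (0 : V) 2).exists_bound_of_continuousOn hcont.continuousOn
  refine ⟨ψ, max C 1, hψ, fun w => ?_, fun w => ?_, hid⟩
  · -- derivative bound: compactness on `‖w‖ ≤ 2`, `Dψ = id` on the open set `2 < ‖w‖`
    rcases le_or_gt ‖w‖ 2 with hw | hw
    · exact (hC w (mem_closedBall_zero_iff.2 hw)).trans (le_max_left _ _)
    · have hev : ψ =ᶠ[𝓝 w] fun w' => w' := by
        filter_upwards [(isOpen_lt continuous_const continuous_norm).mem_nhds hw] with w' hw'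
        exact hid w' (by nlinarith [norm_nonneg w', hw'.le])
      rw [hev.fderiv_eq, fderiv_fun_id]
      exact ContinuousLinearMap.norm_id_le.trans (le_max_right _ _)
  · -- cubic bound at the origin
    change ‖Real.smoothTransition (‖w‖ ^ 2 - 1) • w‖ ≤ ‖w‖ ^ 3
    rw [norm_smul, Real.norm_of_nonneg (Real.smoothTransition.nonneg _)]
    rcases le_or_gt (‖w‖ ^ 2) 1 with hw | hw
    · rw [Real.smoothTransition.zero_of_nonpos (by linarith), zero_mul]
      positivity
    · have h1 : 1 ≤ ‖w‖ := by nlinarith [norm_nonneg w]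
      calc Real.smoothTransition (‖w‖ ^ 2 - 1) * ‖w‖ ≤ 1 * ‖w‖ := by
            gcongr
            exact Real.smoothTransition.le_one _
        _ ≤ ‖w‖ ^ 3 := by
            rw [one_mul]
            exact le_self_pow₀ h1 three_ne_zero

section Rescaled

variable {X V : Type*} [NormedAddCommGroup V] [NormedSpace ℝ V]

/-- Chain rule bound for the rescaled range truncation `x ↦ c⁻¹ ψ(c u(x))`:
`‖D(c⁻¹ ψ ∘ (c u))(x)‖ ≤ L ‖Du(x)‖` when `‖Dψ‖ ≤ L`. -/
theorem norm_fderiv_rescaled_comp_le [NormedAddCommGroup X] [NormedSpace ℝ X] {ψ : V → V}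
    {L : ℝ} (hψ : ContDiff ℝ 1 ψ) (hDψ : ∀ w, ‖fderiv ℝ ψ w‖ ≤ L) {u : X → V}
    (hu : ContDiff ℝ 1 u) {c : ℝ} (hc : 0 < c) (x : X) :
    ‖fderiv ℝ (fun y => c⁻¹ • ψ (c • u y)) x‖ ≤ L * ‖fderiv ℝ u x‖ := by
  have hd : HasFDerivAt (fun y => c⁻¹ • ψ (c • u y))
      (c⁻¹ • (fderiv ℝ ψ (c • u x)).comp (c • fderiv ℝ u x)) x :=
    (((hψ.differentiable one_ne_zero) _).hasFDerivAt.comp x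
      (((hu.differentiable one_ne_zero) x).hasFDerivAt.const_smul c)).const_smul c⁻¹
  rw [hd.fderiv, norm_smul, Real.norm_of_nonneg (inv_nonneg.2 hc.le)]
  calc c⁻¹ * ‖(fderiv ℝ ψ (c • u x)).comp (c • fderiv ℝ u x)‖
      ≤ c⁻¹ * (L * (c * ‖fderiv ℝ u x‖)) := by
        gcongr
        calc ‖(fderiv ℝ ψ (c • u x)).comp (c • fderiv ℝ u x)‖
            ≤ ‖fderiv ℝ ψ (c • u x)‖ * ‖c • fderiv ℝ u x‖ :=
              ContinuousLinearMap.opNorm_comp_le _ _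
          _ ≤ L * (c * ‖fderiv ℝ u x‖) := by
              rw [norm_smul, Real.norm_of_nonneg hc.le]
              gcongr
              exact hDψ _
    _ = L * ‖fderiv ℝ u x‖ := by field_simp

/-- Size of the rescaled range truncation: `‖c⁻¹ ψ(c u(x))‖ ≤ c² ‖u x‖³` when `‖ψ w‖ ≤ ‖w‖³`. -/
theorem norm_rescaled_comp_le {ψ : V → V} (hψ3 : ∀ w, ‖ψ w‖ ≤ ‖w‖ ^ 3) (u : X → V)
    {c : ℝ} (hc : 0 < c) (x : X) : ‖c⁻¹ • ψ (c • u x)‖ ≤ c ^ 2 * ‖u x‖ ^ 3 := by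
  rw [norm_smul, Real.norm_of_nonneg (inv_nonneg.2 hc.le)]
  calc c⁻¹ * ‖ψ (c • u x)‖ ≤ c⁻¹ * ‖c • u x‖ ^ 3 := by
        gcongr
        exact hψ3 _
    _ = c ^ 2 * ‖u x‖ ^ 3 := by
        rw [norm_smul, Real.norm_of_nonneg hc.le, mul_pow]
        field_simp

/-- The rescaled range truncations converge pointwise (they are eventually constant):
`(n+1)⁻¹ ψ((n+1) u(x)) → u(x)` when `‖ψ w‖ ≤ ‖w‖³` and `ψ = id` on `{‖w‖² ≥ 2}`. -/
theorem tendsto_rescaled_comp {ψ : V → V} (hψ3 : ∀ w, ‖ψ w‖ ≤ ‖w‖ ^ 3)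
    (hid : ∀ w, 2 ≤ ‖w‖ ^ 2 → ψ w = w) (u : X → V) (x : X) :
    Tendsto (fun n : ℕ => ((n : ℝ) + 1)⁻¹ • ψ (((n : ℝ) + 1) • u x)) atTop (𝓝 (u x)) := by
  have hc : ∀ n : ℕ, (0 : ℝ) < n + 1 := fun n => by positivity
  by_cases hx : u x = 0
  · have hψ0 : ψ 0 = 0 := by
      have := hψ3 0
      simpa using this
    have : (fun n : ℕ => ((n : ℝ) + 1)⁻¹ • ψ (((n : ℝ) + 1) • u x)) = fun _ => u x := by
      funext n
      simp [hx, hψ0]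
    rw [this]
    exact tendsto_const_nhds
  · have hpos : 0 < ‖u x‖ ^ 2 := by positivity
    obtain ⟨N, hN⟩ := exists_nat_ge (2 / ‖u x‖ ^ 2)
    refine tendsto_atTop_of_eventually_const (i₀ := N) fun n hn => ?_
    have hNn : (N : ℝ) ≤ n := by exact_mod_cast hn
    rw [div_le_iff₀ hpos] at hN
    have h2 : 2 ≤ ‖((n : ℝ) + 1) • u x‖ ^ 2 := by
      rw [norm_smul, Real.norm_of_nonneg (hc n).le, mul_pow]
      have : (0 : ℝ) ≤ n * ((n + 2) * ‖u x‖ ^ 2) := by positivity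
      nlinarith [hpos.le]
    rw [hid _ h2, inv_smul_smul₀ (hc n).ne']

end Rescaled

/-- `u ∈ L⁶ ⇒ ‖u‖³ ∈ L²`. -/
theorem memLp_norm_pow_three {X V : Type*} [MeasurableSpace X] {μ : Measure X}
    [NormedAddCommGroup V] {u : X → V} (hu6 : MemLp u 6 μ) :
    MemLp (fun x => ‖u x‖ ^ 3) 2 μ := by
  have h := hu6.norm_rpow_div (3 : ℝ≥0∞)
  have h63 : (6 : ℝ≥0∞) / 3 = 2 := by
    symm
    rw [ENNReal.eq_div_iff (by norm_num) (by norm_num)]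
    norm_num
  rw [h63] at h
  simpa only [ENNReal.toReal_ofNat, Real.rpow_ofNat] using h

/-- `‖Du‖_{L²} ≤ (∫ |Du|_F²)^{1/2}`: the operator norm of the derivative is dominated pointwise by
its Frobenius norm (`sq_opNorm_le_frobeniusNormSq`). -/
theorem eLpNorm_fderiv_two_le_lintegral_frobeniusNormSq {X V : Type*} [NormedAddCommGroup X]
    [InnerProductSpace ℝ X] [FiniteDimensional ℝ X] [MeasurableSpace X] (μ : Measure X)
    [NormedAddCommGroup V] [InnerProductSpace ℝ V] (u : X → V) :
    eLpNorm (fderiv ℝ u) 2 μ ≤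
      (∫⁻ y, ENNReal.ofReal (frobeniusNormSq (fderiv ℝ u y)) ∂μ) ^ (1 / 2 : ℝ) := by
  rw [eLpNorm_eq_lintegral_rpow_enorm_toReal two_ne_zero ENNReal.ofNat_ne_top,
    ENNReal.toReal_ofNat]
  gcongr with x
  rw [show (2 : ℝ) = ((2 : ℕ) : ℝ) by norm_num, ENNReal.rpow_natCast, ← ofReal_norm,
    ← ENNReal.ofReal_pow (norm_nonneg _)]
  exact ENNReal.ofReal_le_ofReal (sq_opNorm_le_frobeniusNormSq _)

end SobolevSix

/-- **stub 2a — `stub_sobolevSixFrobenius`: the Gagliardo–Nirenberg–Sobolev inequality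
`Ḣ¹ ∩ L⁶ ⊂ L⁶` on `ℝ³` without compact support, Frobenius form.** There is a constant `K` such
that every `C¹` field `u : ℝ³ → ℝ³` with `u ∈ L⁶` satisfies
`‖u‖_{L⁶} ≤ K (∫ |∇u|_F²)^{1/2}`, `|∇u(y)|_F² = frobeniusNormSq (fderiv ℝ u y)`; the hypothesis
`u ∈ L⁶` only excludes the constants (range truncation `u_n = (n+1)⁻¹ ψ((n+1) u) ∈ C¹ ∩ L²`,
the tree's `eLpNorm_six_le_eLpNorm_fderiv_two`, `‖Du_n‖ ≤ L ‖Du‖`, Fatou in `L⁶`, and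
`‖L‖² ≤ |L|_F²`). The constant is `K = SNormLESNormFDerivOfEqConst ℝ³ volume 2 · L`. -/
theorem stub_sobolevSixFrobenius :
    ∃ K : NNReal, ∀ u : EuclideanSpace ℝ (Fin 3) → EuclideanSpace ℝ (Fin 3),
      ContDiff ℝ 1 u → MeasureTheory.MemLp u 6 MeasureTheory.volume →
      MeasureTheory.eLpNorm u 6 MeasureTheory.volume ≤
        (K : ENNReal) * (∫⁻ y, ENNReal.ofReal
          (Literature.Analysis.FluidPDE.frobeniusNormSq (fderiv ℝ u y))) ^ (1 / 2 : ℝ) := by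
  obtain ⟨ψ, L, hψ, hDψ, hψ3, hψid⟩ := SobolevSix.exists_rangeCutoff (EuclideanSpace ℝ (Fin 3))
  set K₀ : ℝ≥0 := SNormLESNormFDerivOfEqConst (EuclideanSpace ℝ (Fin 3))
    (volume : Measure (EuclideanSpace ℝ (Fin 3))) 2 with hK₀
  refine ⟨K₀ * L.toNNReal, fun u hu hu6 => ?_⟩
  -- the range truncations `u_n = (n+1)⁻¹ ψ((n+1) u)`
  set un : ℕ → EuclideanSpace ℝ (Fin 3) → EuclideanSpace ℝ (Fin 3) :=
    fun n x => ((n : ℝ) + 1)⁻¹ • ψ (((n : ℝ) + 1) • u x)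
  have hc : ∀ n : ℕ, (0 : ℝ) < n + 1 := fun n => by positivity
  have h1 : ∀ n, ContDiff ℝ 1 (un n) := fun n =>
    (hψ.comp (hu.const_smul ((n : ℝ) + 1))).const_smul ((n : ℝ) + 1)⁻¹
  -- `‖u_n x‖ ≤ (n+1)² ‖u x‖³`, so `u_n ∈ L²`
  have h2 : ∀ n, eLpNorm (un n) 2 volume < ⊤ := fun n => by
    refine ((SobolevSix.memLp_norm_pow_three hu6).of_le_mul (c := ((n : ℝ) + 1) ^ 2)
      (h1 n).continuous.aestronglyMeasurable (Eventually.of_forall fun x => ?_)).eLpNorm_lt_top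
    rw [Real.norm_of_nonneg (by positivity)]
    exact SobolevSix.norm_rescaled_comp_le hψ3 u (hc n) x
  -- `‖Du_n‖ ≤ L ‖Du‖` pointwise, hence in `L²`
  have h3 : ∀ n, eLpNorm (fderiv ℝ (un n)) 2 volume ≤
      ENNReal.ofReal L * eLpNorm (fderiv ℝ u) 2 volume := fun n =>
    eLpNorm_le_mul_eLpNorm_of_ae_le_mul (Eventually.of_forall fun x =>
      SobolevSix.norm_fderiv_rescaled_comp_le hψ hDψ hu (hc n) x) 2
  -- GNS for each truncation
  have hGNS : ∀ n, eLpNorm (un n) 6 volume ≤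
      K₀ * (ENNReal.ofReal L * eLpNorm (fderiv ℝ u) 2 volume) := fun n =>
    (eLpNorm_six_le_eLpNorm_fderiv_two volume finrank_euclideanSpace_fin (h1 n) (h2 n)).trans
      (by rw [← hK₀]; gcongr; exact h3 n)
  -- pointwise convergence and Fatou in `L⁶`
  have hlim : ∀ x, Tendsto (fun n => un n x) atTop (𝓝 (u x)) := fun x =>
    SobolevSix.tendsto_rescaled_comp hψ3 hψid u x
  have hFatou : eLpNorm u 6 volume ≤ atTop.liminf fun n => eLpNorm (un n) 6 volume :=
    Lp.eLpNorm_lim_le_liminf_eLpNorm (fun n => (h1 n).continuous.aestronglyMeasurable) u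
      (Eventually.of_forall hlim)
  calc eLpNorm u 6 volume ≤ atTop.liminf fun n => eLpNorm (un n) 6 volume := hFatou
    _ ≤ K₀ * (ENNReal.ofReal L * eLpNorm (fderiv ℝ u) 2 volume) :=
        liminf_le_of_frequently_le' (Frequently.of_forall hGNS)
    _ = ((K₀ * L.toNNReal : ℝ≥0) : ℝ≥0∞) * eLpNorm (fderiv ℝ u) 2 volume := by
        rw [ENNReal.coe_mul, mul_assoc]
        rfl
    _ ≤ ((K₀ * L.toNNReal : ℝ≥0) : ℝ≥0∞) *
        (∫⁻ y, ENNReal.ofReal (frobeniusNormSq (fderiv ℝ u y))) ^ (1 / 2 : ℝ) := by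
        gcongr
        exact SobolevSix.eLpNorm_fderiv_two_le_lintegral_frobeniusNormSq volume u

end Summit.NavierStokesRegularity.NavierStokesRegularity.Theorems.ParabolicGaldiLiouville.Birth

end
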